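import Literature.NumberTheory.EllipticCurves.EulerLatticeReductionCountProofs
import Literature.NumberTheory.EllipticCurves.HeegnerPointsKolyvaginGoodReductionProofs
import Literature.NumberTheory.EllipticCurves.ZpExtensionRamifiedResidueBoundProofs
import Literature.NumberTheory.EllipticCurves.CastellaGrossiLeeSkinner2022.HowardDivisibilityAnyClassNumber
import HarnessLib

/-!
# ORDINARY ASCENT: good ordinary reduction of `E/ℚ` at `p` gives good ORDINARY reduction of `E_K` at every place `w ∣ p`
# (`a_w ≡ a_p^{f(w|p)} (mod p)`); the compact control map lands in `H¹_{F_𝔮}(K, T_𝔮)` on the `Thm413Hypotheses` frames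
# (proofs file; no definition, no named fact, no instance, no notation)

Topic `NumberTheory/EllipticCurves`. THEOREMS ONLY. Assembly of tree theorems: `EulerLattice.exists_place_under` (the place of
`ℚ` under `w ∋ p`), `hasGoodReductionAtPrime_iff_hasGoodReductionAt_ringOfIntegers` (`LFunctionPrimeCoeff`),
`hasGoodReductionAt_baseChange_of_hasGoodReductionAt_rat` (`HeegnerPointsKolyvaginGoodReductionProofs`),
`WeierstrassCurve.frobeniusTraceAt_baseChange_eq_eval_dickson` (`FrobeniusTraceBaseChange`: `a_w(E ⊗ K) = D_{f(w|v)}(a_v; q_v)`),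
`frobeniusTraceAt_eq_frobeniusTrace` (`IsogenyFrobeniusTraceProofs`) and x10b-p1-w2 g7's
`LambdaAdicSelmerData.toEisensteinH1Linear_mem_ordinarySelmer_of_isAnticyclotomic` (`ZpExtensionRamifiedResidueBoundProofs`).

WHAT (cell `pub/bsd-print-x9`, seat `bsd-line-x10b-p1-w2` g9, (C10); for the shared μ-crux `MuInequalityCoherentPairOfHoward`,
stmt-BirchSwinnertonDyer-23088, whose skeleton quantifies over `S, hpS, hbad, …, t, ht, I` on frames
`CastellaGrossiLeeSkinner2022.Thm413Hypotheses N W K p κ γ` with `hyp.ordinary : IsOrdinaryAt W p`).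
* §1 `dvd_eval_dickson_one_sub_pow` — `d ∣ D_{n+1}(a; d) − a^{n+1}` for `Polynomial.dickson 1 d` (two-step induction on the
  recurrence `D_{n+2} = X D_{n+1} − d D_n`).
* §2 **`WeierstrassCurve.hasGoodReductionAt_baseChange_of_hasGoodReductionAtPrime`** (good at `p` ⇒ `E_K` good at every
  `w ∣ p`), `natCast_dvd_frobeniusTraceAt_baseChange_sub_pow` (`p ∣ a_w(E_K) − a_p^{f(w|p)}`, `W/ℚ` globally minimal),
  **`not_dvd_frobeniusTraceAt_baseChange_of_isOrdinaryAt`** (`IsOrdinaryAt W p` ⇒ `p ∤ a_w(E_K)` at every `w ∣ p`: `f ≥ 1`,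
  `Int.Prime.dvd_pow'`), `mem_of_mem_badPlaces` (the skeleton's `(hpS, hbad)` put every bad place in `S`).
* §3 **`LambdaAdicSelmerData.toEisensteinH1Linear_mem_ordinarySelmer_of_thm413Hypotheses`** — on the frames: for every
  `m ≥ 1`, `t, ht`, pin `I` (sign `κ⁻ = κ.unitTwist (-1)`) and `(S, hpS, hbad)`:
  `toEisensteinH1Linear … s ∈ I.ordinarySelmer S (fun v _ ↦ (W.baseChange K).ordinaryFiltrationAt v t ht)` for all `s ∈ 𝔖` —
  the hypothesis `hf` of `PrintX10bCompactControl.exists_forall_compactInputs_eisensteinDVRSetting` (`Theorems/PrintX10bControlCompactGlueSetting`)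
  and of the packages of `Theorems/PrintX10bControlCompactGlue`, discharged with NO residual hypothesis beyond the frame.
The same two §2 facts are the `hgood`/`hord` inputs OVER `K` of the D1 lineage's H.4 clauses at `v ∣ p`
(`ZpExtensionEisensteinOrdinaryCoreIsotropy[OfLifts]Proofs`). HONEST FRAMING: bookkeeping between the tree's rational-prime
and place currencies plus Silverman V.2.3.1; nothing about Selmer groups beyond the cited containment is proved; BSD is not
proved by any of this; no summit statement is proved by this seat.

References: [SilvermanAEC2009] J. Silverman, *The Arithmetic of Elliptic Curves*, 2nd ed. (2009): Thm. V.2.3.1 and its proof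
(`#E(𝔽_{qⁿ}) = qⁿ + 1 − αⁿ − βⁿ`), Ex. 5.10(a) (supersingular iff `a ≡ 0`), Prop. VII.5.1(a), C.21 Remark 21.3;
[Howard2004HeegnerKolyvagin] B. Howard, Compositio Math. 140 (2004), §2.2 Lemma 2.2.7, Prop. 2.2.8, Def. 3.1.2 (`F_𝔮`,
ordinary at `v ∣ p`); [CastellaGrossiLeeSkinner2022] F. Castella, G. Grossi, J. Lee, C. Skinner, Invent. Math. 227 (2022),
§3.2 (standing hypotheses: `p ∤ N` good ordinary, `K` imaginary quadratic, anticyclotomic `Γ`); [NeukirchANT1999] Ch. I §8.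
-/

set_option autoImplicit false

noncomputable section

open scoped NumberField ContRepresentation Classical
open NumberField IsDedekindDomain Field Polynomial

namespace Literature.NumberTheory.EllipticCurves

/-! ## §1 The Dickson congruence `D_n(a; d) ≡ a^n (mod d)`, `n ≥ 1` -/

/-- **`D_{n+1}(a; d) ≡ a^{n+1} (mod d)`** for Mathlib's Dickson polynomial of the first kind `Polynomial.dickson 1 d`
(`D₀ = 2`, `D₁ = X`, `D_{n+2} = X D_{n+1} − d D_n`): with `λ + μ = a`, `λμ = d`, `λ^{n+1} + μ^{n+1} ≡ a^{n+1}` modulo `d`.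
[cite: SilvermanAEC2009, Thm. V.2.3.1 (proof: #E(𝔽_{qⁿ}) = qⁿ + 1 − αⁿ − βⁿ)] -/
theorem dvd_eval_dickson_one_sub_pow (a d : ℤ) (n : ℕ) :
    d ∣ (Polynomial.dickson 1 d (n + 1)).eval a - a ^ (n + 1) := by
  have key : ∀ n : ℕ, (d ∣ (Polynomial.dickson 1 d (n + 1)).eval a - a ^ (n + 1)) ∧
      (d ∣ (Polynomial.dickson 1 d (n + 2)).eval a - a ^ (n + 2)) := by
    intro n
    induction n with
    | zero =>
      refine ⟨?_, ?_⟩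
      · rw [zero_add, Polynomial.dickson_one, Polynomial.eval_X, pow_one, sub_self]
        exact dvd_zero d
      · rw [zero_add, Polynomial.dickson_two]
        simp only [eval_sub, eval_pow, eval_X, eval_mul, eval_C, eval_ofNat, Nat.cast_one, eval_one]
        exact ⟨-2, by ring⟩
    | succ n ih =>
      refine ⟨ih.2, ?_⟩
      rw [show n + 1 + 2 = n + 1 + 2 from rfl, Polynomial.dickson_add_two 1 d (n + 1)]
      simp only [eval_sub, eval_mul, eval_X, eval_C]
      have h2 := ih.2
      have e : a * (Polynomial.dickson 1 d (n + 1 + 1)).eval a - d * (Polynomial.dickson 1 d (n + 1)).eval a -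
          a ^ (n + 1 + 2) =
        a * ((Polynomial.dickson 1 d (n + 2)).eval a - a ^ (n + 2)) - d * (Polynomial.dickson 1 d (n + 1)).eval a := by
        ring
      rw [e]
      exact dvd_sub (dvd_mul_of_dvd_right h2 a) (dvd_mul_right d _)
  exact (key n).1

end Literature.NumberTheory.EllipticCurves

/-! ## §2 Good and ordinary reduction ascend to the places above `p` -/

namespace WeierstrassCurve

open Literature.NumberTheory.EllipticCurves Rat.HeightOneSpectrum
open Literature.NumberTheory.EllipticCurves.EulerLattice

variable {K : Type} [Field K] [NumberField K] (W : WeierstrassCurve ℚ) [W.IsElliptic] [W.IsGloballyMinimal]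
  {p : ℕ} [hp : Fact p.Prime]

omit [W.IsGloballyMinimal] in
/-- **Good reduction ascends**: if `E/ℚ` has good reduction at `p`, then `E_K = E ⊗ K` has good reduction at every place
`w ∣ p` of `K`. [cite: SilvermanAEC2009, Prop. VII.5.1(a) and VII.1 Remark 1.3] -/
theorem hasGoodReductionAt_baseChange_of_hasGoodReductionAtPrime (hgood : W.HasGoodReductionAtPrime p)
    (w : HeightOneSpectrum (𝓞 K)) (hw : ((p : ℕ) : 𝓞 K) ∈ w.asIdeal) :
    (W.baseChange K).HasGoodReductionAt w := by
  obtain ⟨v, hwv, hvp⟩ := exists_place_under w hw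
  subst hvp
  have hv : W.HasGoodReductionAt v := (hasGoodReductionAtPrime_iff_hasGoodReductionAt_ringOfIntegers v W).mp hgood
  haveI : w.asIdeal.LiesOver v.asIdeal := ⟨hwv.symm⟩
  exact hasGoodReductionAt_baseChange_of_hasGoodReductionAt_rat W v w hv

/-- **`a_w(E_K) ≡ a_p^{f(w|p)} (mod p)`** at a place `w ∣ p` of good reduction: `a_w = λ^f + μ^f = D_f(a_p; p)`
(`frobeniusTraceAt_baseChange_eq_eval_dickson`, `frobeniusTraceAt_eq_frobeniusTrace`) and `D_f(a; p) ≡ a^f (mod p)`.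
[cite: SilvermanAEC2009, Thm. V.2.3.1 (proof) and C.21 Remark 21.3] -/
theorem natCast_dvd_frobeniusTraceAt_baseChange_sub_pow (hgood : W.HasGoodReductionAtPrime p)
    (w : HeightOneSpectrum (𝓞 K)) (hw : ((p : ℕ) : 𝓞 K) ∈ w.asIdeal) :
    (p : ℤ) ∣ (W.baseChange K).frobeniusTraceAt w - W.frobeniusTrace p ^ w.asIdeal.inertiaDeg (𝓞 ℚ) := by
  obtain ⟨v, hwv, hvp⟩ := exists_place_under w hw
  subst hvp
  have hv : W.HasGoodReductionAt v := (hasGoodReductionAtPrime_iff_hasGoodReductionAt_ringOfIntegers v W).mp hgood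
  have htrace := frobeniusTraceAt_baseChange_eq_eval_dickson W K hwv hv
  rw [frobeniusTraceAt_eq_frobeniusTrace] at htrace
  have hqv : v.residueCard = (primesEquiv v : ℕ) := by
    rw [← natCard_residueField_eq_residueCard, natCard_residueField_adicCompletionIntegers v]
  rw [hqv] at htrace
  -- `f ≥ 1`
  haveI : w.asIdeal.IsPrime := w.isPrime
  obtain ⟨f, hf⟩ : ∃ f, w.asIdeal.inertiaDeg (𝓞 ℚ) = f + 1 :=
    Nat.exists_eq_add_one_of_ne_zero (Ideal.inertiaDeg_pos (R := 𝓞 ℚ) w.asIdeal).ne'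
  rw [htrace, hf]
  exact dvd_eval_dickson_one_sub_pow _ _ f

/-- **Ordinary reduction ascends**: for `E/ℚ` globally minimal, good ordinary at `p` (`IsOrdinaryAt W p`: good at `p`
and `p ∤ a_p`), at every place `w ∣ p` of `K` the base change `E_K` has good reduction and **`p ∤ a_w(E_K)`**.
[cite: SilvermanAEC2009, Thm. V.2.3.1 (proof), Prop. VII.5.1(a)] -/
theorem not_dvd_frobeniusTraceAt_baseChange_of_isOrdinaryAt (hord : IsOrdinaryAt W p)
    (w : HeightOneSpectrum (𝓞 K)) (hw : ((p : ℕ) : 𝓞 K) ∈ w.asIdeal) :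
    ¬ ((p : ℤ) ∣ (W.baseChange K).frobeniusTraceAt w) := by
  intro hdvd
  have hsub := W.natCast_dvd_frobeniusTraceAt_baseChange_sub_pow hord.1 w hw
  have hpow : (p : ℤ) ∣ W.frobeniusTrace p ^ w.asIdeal.inertiaDeg (𝓞 ℚ) := by
    have := dvd_sub hdvd hsub
    rwa [sub_sub_cancel] at this
  exact hord.2 (Int.Prime.dvd_pow' hp.out hpow)

omit hp in
/-- The bad places lie in any finite set `S` containing the places above `p` outside which (and off `p`) the
reduction is good — the pair `(hpS, hbad)` of the μ-crux skeleton. [cite: SilvermanAEC2009, VII.5] -/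
theorem mem_of_mem_badPlaces {V : WeierstrassCurve K} (S : Finset (HeightOneSpectrum (𝓞 K)))
    (hpS : ∀ v, ((p : ℕ) : 𝓞 K) ∈ v.asIdeal → v ∈ S)
    (hbad : ∀ v, v ∉ S → ((p : ℕ) : 𝓞 K) ∉ v.asIdeal → V.HasGoodReductionAt v)
    (v : HeightOneSpectrum (𝓞 K)) (hv : v ∈ V.badPlaces (𝓞 K)) : v ∈ S := by
  by_contra hvS
  by_cases hpv : ((p : ℕ) : 𝓞 K) ∈ v.asIdeal
  · exact hvS (hpS v hpv)
  · exact (mem_badPlaces_iff V v).1 hv (hbad v hvS hpv)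

end WeierstrassCurve

/-! ## §3 `f_m(𝔖) ⊆ H¹_{F_𝔮}(K, T_𝔮)` on the `Thm413Hypotheses` frames -/

namespace WeierstrassCurve.LambdaAdicSelmerData

open Literature.NumberTheory.EllipticCurves Literature.NumberTheory.GaloisRepresentations

variable {N : ℕ} {W : WeierstrassCurve ℚ} [W.IsGloballyMinimal] {K : Type} [Field K] [NumberField K]
  {p : ℕ} [hp : Fact p.Prime] {κ : ZpExtension K p} {γ : absoluteGaloisGroup K}

/-- **The compact control map lands in `H¹_{F_𝔮}(K, T_𝔮)` on the frames of the shared μ-letter.** Under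
`Thm413Hypotheses N W K p κ γ` (K imaginary quadratic, `p` odd, good ordinary at `p`, `κ` anticyclotomic, `E(K)[p] = 0`, `γ` a
topological generator), for every `m ≥ 1`, every transition datum `t, ht`, every pin `I` of `H¹(K, T_𝔮)` (sign `κ⁻`) and every
finite set `S` with the skeleton's `(hpS, hbad)`: `toEisensteinH1Linear … s ∈ I.ordinarySelmer S Φ_t` for all `s ∈ 𝔖` —
x10b-p1-w2 g7's `toEisensteinH1Linear_mem_ordinarySelmer_of_isAnticyclotomic` with its `hgood/hord/hS` discharged by §2.
This is the hypothesis `hf` of `PrintX10bCompactControl.exists_forall_compactInputs_eisensteinDVRSetting`.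
[cite: Howard2004HeegnerKolyvagin, §2.2 Lemma 2.2.7 and Prop. 2.2.8; Def. 3.1.2] [cite: CastellaGrossiLeeSkinner2022, §3.2 standing hypotheses] -/
theorem toEisensteinH1Linear_mem_ordinarySelmer_of_thm413Hypotheses [NeZero N]
    (hyp : CastellaGrossiLeeSkinner2022.Thm413Hypotheses N W K p κ γ)
    (D : haveI := hyp.isElliptic; (W.baseChange K).LambdaAdicSelmerData κ γ) {m : ℕ} (hm : 1 ≤ m)
    (t : ∀ k, ((W.baseChange K).torsionGaloisModule ((p : ℤ) ^ (k + 1))).toContRepresentation →ⁱL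
      ((W.baseChange K).torsionGaloisModule ((p : ℤ) ^ k)).toContRepresentation)
    (ht : ∀ k (P : geomTorsion (W.baseChange K) ((p : ℤ) ^ (k + 1))), t k P = (W.baseChange K).geomTorsionReduce p k P)
    (I : ZpExtension.EisensteinH1Data (κ.unitTwist (-1)) (fun k ↦ (W.baseChange K).torsionGaloisModule ((p : ℤ) ^ k)) t hm)
    (S : Finset (HeightOneSpectrum (𝓞 K)))
    (hpS : ∀ v, ((p : ℕ) : 𝓞 K) ∈ v.asIdeal → v ∈ S)
    (hbad : ∀ v, v ∉ S → ((p : ℕ) : 𝓞 K) ∉ v.asIdeal → (W.baseChange K).HasGoodReductionAt v) (s : D.S) :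
    haveI := hyp.isElliptic
    D.toEisensteinH1Linear hm t ht I hyp.topGenerator hyp.noPTorsion s ∈
      I.ordinarySelmer S (fun v _ ↦ (W.baseChange K).ordinaryFiltrationAt v t ht) := by
  haveI := hyp.isElliptic
  exact D.toEisensteinH1Linear_mem_ordinarySelmer_of_isAnticyclotomic hm t ht I hyp.isImaginaryQuadratic hyp.p_ne_two
    hyp.anticyclotomic hyp.topGenerator hyp.noPTorsion S
    (fun v hv ↦ WeierstrassCurve.mem_of_mem_badPlaces (p := p) S hpS hbad v hv) s
    (fun v hv ↦ W.hasGoodReductionAt_baseChange_of_hasGoodReductionAtPrime hyp.ordinary.1 v hv)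
    (fun v hv ↦ W.not_dvd_frobeniusTraceAt_baseChange_of_isOrdinaryAt hyp.ordinary v hv)

end WeierstrassCurve.LambdaAdicSelmerData

end
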